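/-
Copyright (c) 2026 the pub-hodgecm-mathlib formalisation cell (harness21).  Prover seat hodgecm-mathlib-K2Liu-p08 (g4), Track B «K2-LIT» ∕ hLiu418
#184♮, socket #42S organ S1 (ROAD W), brick F7∕F8 (T3-frame (iii-c), «the Gram is basis-free») (LEAD F0P6-plan (g14) BATCH #8 (4) «(iii) `cells_equiv` = K2Liu-p08»;
K2Liu-p01 (g8) SPEC-F7-FrameStep ab42186030930277 §2 (iii), 12:28:30Z «κ := κ₀ ≫ reading ≫ epsV ≫ frame change»).  2026-09-04.  KERNEL: theorems only.
-/
import Mathlib.Data.Matrix.Mul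
import Mathlib.LinearAlgebra.Matrix.Notation
import Mathlib.Tactic.Ring
import HarnessLib

/-!
# Crux `HLiu418`, #42S-S1 ROAD W, brick (T3-frame (iii-c)): THE HERMITIAN GRAM IS BASIS-FREE — DIAGONAL COORDINATES ↦ HYPERBOLIC-FRAME COORDINATES

Cell `hodgecm-mathlib`, crux item hLiu418 = `stmt-HodgeConjecture-24832` (helper lane `--supports … --as helper`, count-neutral).  THEOREMS ONLY (no `def`, no instance,
no notation, no named-fact hypothesis, no `sorry`).  GENERIC matrix algebra (any commutative ring `R`, any ring endomorphism `σ`): ★ (T3a) `K2LiuSiegelUnipotentPairingGram` writes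
the pairing through the Gram `G j i = Σ_k Σ_l b_j(l)·D_{kl}·σ(b_i(k)) = (D *ᵥ b_j) ⬝ᵥ (σ ∘ b_i)` of the DIAGONAL coordinates `b_j` (`D = gramS(realDiagonal dV′)`), while ★ (T3-core) ∕
★ (T3-core-split) count in the HYPERBOLIC frame `(u, u′, ℓ)` of ★ (ii-a) `K2LiuHyperbolicPairOfIsotropicNorm` (Gram `M = [[0,1,0],[1,0,0],[0,0,d]]`).  With the frame matrix `P`
(rows = frame vectors in the diagonal basis, `P·Dᵀ·σ(P)ᵀ = M`) and frame coordinates `a_j` (`b_j = a_j ᵥ* P`):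
* `gram_sum_eq_dotProduct` (★ (T3a)'s double sum `= (D *ᵥ b) ⬝ᵥ (σ ∘ b′)`), **`gram_vecMul_vecMul`** (`(D *ᵥ (a ᵥ* P)) ⬝ᵥ (σ ∘ (a′ ᵥ* P)) = a ⬝ᵥ ((P·Dᵀ·σ(P)ᵀ) *ᵥ (σ ∘ a′))`),
  **`gram_eq_of_frame`** (`… = a ⬝ᵥ (M *ᵥ (σ ∘ a′))` when `P·Dᵀ·σ(P)ᵀ = M`), **`dotProduct_hyperbolic_mulVec`** (`a ⬝ᵥ (M_hyp(d) *ᵥ σa′) = a₀σ(a′₁) + a₁σ(a′₀) + d·a₂σ(a′₂)`),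
  and the packaging for the two vectors `x₁, x₂` of a lattice-pair point: ★★ **`gram_eq_vecMulVec_of_frame`**:
  `Σ_k Σ_l b_j(l) D_{kl} σ(b_i(k)) = (A σ(B)ᵀ + B σ(A)ᵀ + d·C σ(C)ᵀ) j i` with `A j = a_j 0`, `B j = a_j 1`, `C j = a_j 2` — EXACTLY ★ (T3-core)'s `G` (inert, `σ`) and, read at `w₀`
  (★ reading `reading_gram_fst`), ★ (T3-core-split)'s `K` (split).
[Shimura1997, §13.2] [Scharlau1985HermitianForms, Ch. 7 §1 (change of basis for hermitian forms)].
HONEST LABEL.  Count-neutral helper; `HC_CM` is proved only modulo the 7 printed citations (2 remaining named inputs: hLiu418 = `stmt-HodgeConjecture-24832`,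
h413 = `stmt-HodgeConjecture-24833`) until rung 0 closes.

## References
* [Shimura1997] G. Shimura, *Euler products and Eisenstein series*, CBMS 93 (1997), §13.2.
* [Scharlau1985HermitianForms] W. Scharlau, *Quadratic and Hermitian Forms*, Grundlehren 270 (1985), Ch. 7 §1.
-/

set_option autoImplicit false
set_option linter.dupNamespace false -- the mandated namespace repeats `HodgeConjecture.HodgeConjecture`

open Matrix

namespace Summit.HodgeConjecture.HodgeConjecture.Cruxes.HLiu418.K2LiuHermitianGramFrameChange

variable {R : Type*} [CommRing R] (σ : R →+* R) {n : Type*} [Fintype n]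

/-- ★ (T3a)'s double sum is a dot product: `Σ_k Σ_l b(l)·D_{kl}·σ(b′(k)) = (D *ᵥ b) ⬝ᵥ (σ ∘ b′)`. [folklore] -/
theorem gram_sum_eq_dotProduct (D : Matrix n n R) (b b' : n → R) :
    (∑ k, ∑ l, b l * D k l * σ (b' k)) = (D *ᵥ b) ⬝ᵥ (σ ∘ b') := by
  simp only [dotProduct, mulVec, Function.comp_apply, Finset.sum_mul]
  refine Finset.sum_congr rfl fun k _ => Finset.sum_congr rfl fun l _ => ?_
  ring

/-- **CHANGE OF FRAME**: for `b = a ᵥ* P`, `b′ = a′ ᵥ* P`: `(D *ᵥ b) ⬝ᵥ (σ ∘ b′) = a ⬝ᵥ ((P * Dᵀ * (P.map σ)ᵀ) *ᵥ (σ ∘ a′))`.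
[cite: Scharlau1985HermitianForms, Ch. 7 §1] -/
theorem gram_vecMul_vecMul (D P : Matrix n n R) (a a' : n → R) :
    (D *ᵥ (a ᵥ* P)) ⬝ᵥ (σ ∘ (a' ᵥ* P)) = a ⬝ᵥ ((P * Dᵀ * (P.map σ)ᵀ) *ᵥ (σ ∘ a')) := by
  have hσ : σ ∘ (a' ᵥ* P) = (σ ∘ a') ᵥ* P.map σ := funext fun i => RingHom.map_vecMul σ P a' i
  rw [hσ, ← vecMul_transpose D, vecMul_vecMul, ← mulVec_transpose (P.map σ), dotProduct_mulVec, vecMul_vecMul, ← dotProduct_mulVec]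

/-- **THE GRAM IS BASIS-FREE**: if the frame matrix satisfies `P·Dᵀ·σ(P)ᵀ = M` then `(D *ᵥ (a ᵥ* P)) ⬝ᵥ (σ ∘ (a′ ᵥ* P)) = a ⬝ᵥ (M *ᵥ (σ ∘ a′))`.
[cite: Scharlau1985HermitianForms, Ch. 7 §1] -/
theorem gram_eq_of_frame {D P M : Matrix n n R} (hP : P * Dᵀ * (P.map σ)ᵀ = M) (a a' : n → R) :
    (D *ᵥ (a ᵥ* P)) ⬝ᵥ (σ ∘ (a' ᵥ* P)) = a ⬝ᵥ (M *ᵥ (σ ∘ a')) := by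
  rw [gram_vecMul_vecMul, hP]

/-- **THE HYPERBOLIC FRAME'S GRAM**: `a ⬝ᵥ ([[0,1,0],[1,0,0],[0,0,d]] *ᵥ (σ ∘ a′)) = a 0·σ(a′ 1) + a 1·σ(a′ 0) + d·a 2·σ(a′ 2)`. [cite: Shimura1997, §13.2] -/
theorem dotProduct_hyperbolic_mulVec (d : R) (a a' : Fin 3 → R) :
    a ⬝ᵥ (!![0, 1, 0; 1, 0, 0; 0, 0, d] *ᵥ (σ ∘ a')) = a 0 * σ (a' 1) + a 1 * σ (a' 0) + d * (a 2 * σ (a' 2)) := by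
  simp only [dotProduct, mulVec, Function.comp_apply, Fin.sum_univ_three]
  simp only [of_apply, cons_val', cons_val_zero, cons_val_one, empty_val', cons_val_fin_one, cons_val_two, Nat.succ_eq_add_one, Nat.reduceAdd,
    tail_cons, head_cons, head_fin_const]
  ring

/-- **PACKAGING FOR A LATTICE-PAIR POINT** (two vectors `x₁, x₂`, frame coordinates `a : Fin 2 → Fin 3 → R`, `A j = a j 0`, `B j = a j 1`, `C j = a j 2`): with
`P·Dᵀ·σ(P)ᵀ = [[0,1,0],[1,0,0],[0,0,d]]` and `b j = a j ᵥ* P`,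
`Σ_k Σ_l b_j(l)·D_{kl}·σ(b_i(k)) = (A σ(B)ᵀ + B σ(A)ᵀ + d·C σ(C)ᵀ) j i` — ★ (T3a)'s Gram IS ★ (T3-core)'s Gram. [cite: Shimura1997, §13.2] [cite: Scharlau1985HermitianForms, Ch. 7 §1] -/
theorem gram_eq_vecMulVec_of_frame {D P : Matrix (Fin 3) (Fin 3) R} {d : R} (hP : P * Dᵀ * (P.map σ)ᵀ = !![0, 1, 0; 1, 0, 0; 0, 0, d])
    (a : Fin 2 → Fin 3 → R) (j i : Fin 2) :
    (∑ k, ∑ l, (a j ᵥ* P) l * D k l * σ ((a i ᵥ* P) k)) =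
      (vecMulVec (fun r => a r 0) (fun r => σ (a r 1)) + vecMulVec (fun r => a r 1) (fun r => σ (a r 0)) + d • vecMulVec (fun r => a r 2) (fun r => σ (a r 2))) j i := by
  rw [gram_sum_eq_dotProduct, gram_eq_of_frame σ hP, dotProduct_hyperbolic_mulVec]
  simp only [add_apply, smul_apply, vecMulVec_apply, smul_eq_mul]

/-- the frame relation is preserved by RESCALING the third frame vector (`ℓ ↦ c·ℓ` changes `d ↦ c·σ(c)·d`): bookkeeping for the depth-`k` lattices `𝔭^k ℓ`.
[cite: Scharlau1985HermitianForms, Ch. 7 §1] -/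
theorem dotProduct_hyperbolic_mulVec_smul_third (d c : R) (a a' : Fin 3 → R) :
    a 0 * σ (a' 1) + a 1 * σ (a' 0) + (c * σ c * d) * (a 2 * σ (a' 2)) = a 0 * σ (a' 1) + a 1 * σ (a' 0) + d * ((c * a 2) * σ (c * a' 2)) := by
  rw [map_mul]
  ring

end Summit.HodgeConjecture.HodgeConjecture.Cruxes.HLiu418.K2LiuHermitianGramFrameChange
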